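import Literature.LinearAlgebra.Matrix.LatimerMacDuffeeIdeal
import HarnessLib

/-!
# The Latimer–MacDuffee–Taussky correspondence completed: every ideal class is the class of a matrix,
# and the classes of matrix roots of `f` are in bijection with the ideal classes of `ℤ[θ]`

Topic `LinearAlgebra/Matrix`, namespace `Literature.LinearAlgebra.Matrix`; third file of the series
`LatimerMacDuffee.lean` (the class-number-one case) / `LatimerMacDuffeeIdeal.lean` (TAUSSKY's Theorems 1–3:
the module `ℤⁿ_A = QuotModule f A hA` of a matrix root `A` of `f` is isomorphic to a nonzero ideal of
`S = ℤ[X]/(f) = AdjoinRoot f`; `ℤⁿ_A ≅ ℤⁿ_B` iff `P A = B P` with `P` unimodular), whose docstrings leave «the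
general correspondence» open.  THEOREMS ONLY: no definition, no instance, no notation, no named fact (net
Literature debt `0`).

## Sources, VERBATIM

O. Taussky, *On a theorem of Latimer and MacDuffee*, Canad. J. Math. 1 (1949) 300–302 [Taussky1949], p. 300:
"Let `f(x) = 0` be an irreducible algebraic equation of degree `n` with integral coefficients. Latimer and
MacDuffee proved that there is a 1-1 correspondence between the classes of matrices `A` with rational integers
as elements which satisfy `f(A) = 0` and the ideal classes of the ring formed by the polynomials in `α` […]
Theorem 1. To every matrix solution `X` of `f(X) = 0` corresponds an ideal `𝔞` of `ℤ[α]` such that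
`α ωᵢ = Σ xᵢₖ ωₖ` for a basis `ω₁, …, ωₙ` of `𝔞`. […] The Theorems 1-4 show that there is a 1-1 correspondence
between the classes of matrices and the ideal classes."  C. G. Latimer, C. C. MacDuffee, *A correspondence
between classes of ideals and classes of matrices*, Ann. of Math. 34 (1933) 313–316 [LatimerMacduffee1933].

K. Iwaki, *Infinite families of standard Cappell–Shaneson homotopy 4-spheres*, Topology Appl. 366 (2025)
[Iwaki2025] (arXiv:2404.05096, held `paper:arxiv-2404.05096`, chunk p0005): "Let `R` be an integral domain. We
can define an equivalence relation `≈` on the set of non zero ideals of `R`, `𝓘(R)`: `I ≈ J` if and only if there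
exists non zero elements `α, β ∈ R` such that `αI = βJ`. […] Theorem 2.18 (Latimer-MacDuffee, Taussky). Suppose
`f ∈ ℤ[x]` is a monic polynomial of degree `n` and irreducible over `ℚ`. Let `θ` be a root of `f`. Then there is
a bijection between `C(ℤ[θ])` and `{A ∈ M(n;ℤ) | f(A) = O}/∼_S`." (also M. H. Kim, S. Yamada, Kyungpook Math. J.
63 (2023) [KimYamada2023], §2.2 Thm. 2.13, the degree-`3` case).

## What is formalised

The order `ℤ[θ]` is `S = AdjoinRoot f` with `f ∈ ℤ[X]` monic of degree `n ≠ 0` and `S` an integral domain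
(`f` irreducible); `θ = AdjoinRoot.root f`.  «Classes of matrices» are the classes of
`{A : Matrix (Fin n) (Fin n) ℤ // aeval A f = 0}` under `A ∼ B :⟺ ∃ P, IsUnit P.det ∧ P * A = B * P`
(conjugation by `GLₙ(ℤ)`); «ideal classes» are the classes of `{J : Ideal S // J ≠ ⊥}` under
`I ≈ J :⟺ ∃ x y ≠ 0, (x)·I = (y)·J`, which §1 identifies with `S`-module isomorphism.

* §1 `nonempty_linearEquiv_iff_exists_span_singleton_mul_eq` («`αI = βJ`» ⟺ `I ≅ J` as `S`-modules, any
  domain).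
* §2 **`QuotModule.exists_aeval_eq_zero_and_nonempty_linearEquiv`** (LATIMER–MACDUFFEE's direction «to every
  ideal class corresponds a class of matrices», the converse of TAUSSKY's Theorem 1): every nonzero ideal `J` of
  `S` is `S`-isomorphic to the module `ℤⁿ_A` of SOME integer matrix `A` with `f(A) = 0` — `J` is a free
  `ℤ`-module of rank `n` (Mathlib's `Ideal.selfBasis` over the PID `ℤ`), and `A` is the matrix of
  multiplication by `θ` on a `ℤ`-basis `ω₁, …, ωₙ` of `J` («`α ωᵢ = Σ xᵢₖ ωₖ`»).
* §3 the class maps in both directions on representatives: `exists_isUnit_det_and_mul_eq_mul_of_linearEquiv`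
  (same ideal class ⟹ conjugate matrices), `exists_span_singleton_mul_eq_of_mul_eq_mul` (conjugate matrices ⟹
  same ideal class).
* §4 **`exists_equiv_quot_conj_quot_idealClass`** (THE CORRESPONDENCE: a bijection `Φ` from the conjugacy classes
  of matrix roots of `f` onto the ideal classes of `S`, characterised by `Φ [A] = [J]` whenever `ℤⁿ_A ≅ J`),
  `exists_equiv_quot_conj_quot_linearEquiv` (the same with module-isomorphism classes) and
  **`natCard_quot_conj_eq_natCard_quot_idealClass`** (the number of classes of matrices with `f(A) = 0` equals
  the ideal class number `#C(ℤ[θ])` of the order, as cardinals `Nat.card`).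
* §5 `aeval_eq_zero_iff_charpoly_eq` (`f(A) = 0 ⟺ χ_A = f` for `f` monic irreducible of degree `n`),
  **`exists_equiv_quot_charpoly_conj_quot_idealClass`** / `natCard_quot_charpoly_conj_eq_natCard_quot_idealClass`
  (the correspondence and the count with KIM–YAMADA's «matrices whose characteristic polynomials are `g`»).
* §6 THE CLASS-NUMBER-ONE CASE AS AN EQUIVALENCE: `idealClass_equivalence` (the relation IS an equivalence
  relation), `idealClass_top_iff_isPrincipal` («the identity element is the class of principal ideals»: a nonzero
  ideal is in the class of `S` iff it is principal), **`natCard_quot_idealClass_eq_one_iff`** /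
  `forall_idealClass_iff_isPrincipalIdealRing` (`#C(S) = 1 ⟺ S` is a principal ideal ring, any domain `S`), and on
  the matrix side **`forall_exists_isUnit_det_iff_isPrincipalIdealRing`** /
  `natCard_quot_charpoly_conj_eq_one_iff` (ALL integer matrices with characteristic polynomial `f` are similar over
  `ℤ` ⟺ there is exactly one similarity class ⟺ `ℤ[θ]` is a principal ideal ring — the converse of the tree's
  `exists_isUnit_det_and_mul_eq_mul_of_isPrincipalIdealRing` of `LatimerMacDuffee.lean` included).
-/

open Polynomial

noncomputable section

namespace Literature.LinearAlgebra.Matrix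

variable {n : ℕ}

/-! ### §1 Ideal classes `αI = βJ` are module-isomorphism classes -/

/-- **«`I ≈ J` iff `αI = βJ` for non zero `α, β`» is `S`-module isomorphism**: for ideals `I ≠ 0`, `J` of an
integral domain `R`, `I ≅ J` as `R`-modules iff `(x)·I = (y)·J` for some `x, y ≠ 0` (⟸ is the tree's
`linearEquivOfSpanSingletonMulEq`; ⟹: an isomorphism `e` is multiplication by `e(j₀)/j₀` for any
`0 ≠ j₀ ∈ I`, since `j₀·e(j) = e(j₀ j) = j·e(j₀)`). [cite: Iwaki2025, §2.3 (the relation `≈` and `C(R)`),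
Thm. 2.18] [cite: Taussky1949, Theorem 2] -/
theorem nonempty_linearEquiv_iff_exists_span_singleton_mul_eq {R : Type*} [CommRing R] [IsDomain R]
    {I J : Ideal R} (hI : I ≠ ⊥) :
    Nonempty (I ≃ₗ[R] J) ↔ ∃ x y : R, x ≠ 0 ∧ y ≠ 0 ∧ Ideal.span {x} * I = Ideal.span {y} * J := by
  refine ⟨fun ⟨e⟩ ↦ ?_, fun ⟨x, y, hx, hy, h⟩ ↦ ⟨linearEquivOfSpanSingletonMulEq hx hy h⟩⟩
  obtain ⟨j₀, hj₀I, hj₀⟩ := Submodule.exists_mem_ne_zero_of_ne_bot hI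
  have hcomm : ∀ j : I, (e ⟨j₀, hj₀I⟩ : R) * (j : R) = j₀ * (e j : R) := fun j ↦ by
    have h1 : e ((j : R) • (⟨j₀, hj₀I⟩ : I)) = (j : R) • e ⟨j₀, hj₀I⟩ := map_smul e _ _
    have h2 : e (j₀ • j) = j₀ • e j := map_smul e _ _
    have h3 : (j : R) • (⟨j₀, hj₀I⟩ : I) = j₀ • j := Subtype.ext (mul_comm (j : R) j₀)
    have h4 := congrArg (fun z : J ↦ (z : R)) (h1.symm.trans ((congrArg e h3).trans h2))
    simp only [Submodule.coe_smul, smul_eq_mul] at h4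
    rw [mul_comm]
    exact h4
  refine ⟨(e ⟨j₀, hj₀I⟩ : R), j₀, fun h ↦ hj₀ ?_, hj₀, le_antisymm ?_ ?_⟩
  · have h1 : e ⟨j₀, hj₀I⟩ = 0 := Subtype.ext h
    exact congrArg Subtype.val (e.injective (h1.trans (map_zero e).symm))
  · refine Ideal.span_singleton_mul_le_iff.2 fun z hz ↦ ?_
    rw [hcomm ⟨z, hz⟩]
    exact Ideal.mem_span_singleton_mul.2 ⟨_, (e ⟨z, hz⟩).2, rfl⟩
  · refine Ideal.span_singleton_mul_le_iff.2 fun w hw ↦ ?_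
    have h := hcomm (e.symm ⟨w, hw⟩)
    rw [LinearEquiv.apply_symm_apply] at h
    exact Ideal.mem_span_singleton_mul.2 ⟨_, (e.symm ⟨w, hw⟩).2, h⟩

/-! ### §2 Every nonzero ideal is the module of a matrix root of `f` (LATIMER–MACDUFFEE) -/

namespace QuotModule

variable {f : ℤ[X]} [Fact f.Monic] [IsDomain (AdjoinRoot f)]

/-- **LATIMER–MACDUFFEE / TAUSSKY, the realisation of an ideal class by a matrix: every nonzero ideal `J` of
`ℤ[θ] = ℤ[X]/(f)` (`f` monic of degree `n ≥ 1`, irreducible) is isomorphic, as a `ℤ[θ]`-module, to the module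
`ℤⁿ_A` of some `A ∈ Mₙ(ℤ)` with `f(A) = 0`** — `J` is free of rank `n` over `ℤ` (`Ideal.selfBasis`), and on a
`ℤ`-basis `ω₁, …, ωₙ` of `J` multiplication by `θ` has an integer matrix `A`, «`α ωᵢ = Σ xᵢₖ ωₖ`», with
`f(A) = 0` because `f(θ) = 0`. [cite: Taussky1949, Theorem 1 and p. 300 («there is a 1-1 correspondence»)]
[cite: Iwaki2025, §2.3 Thm. 2.18] -/
theorem exists_aeval_eq_zero_and_nonempty_linearEquiv (hdeg : f.natDegree = n)
    {J : Ideal (AdjoinRoot f)} (hJ : J ≠ ⊥) :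
    ∃ (A : _root_.Matrix (Fin n) (Fin n) ℤ) (hA : aeval A f = 0),
      Nonempty (QuotModule f A hA ≃ₗ[AdjoinRoot f] J) := by
  classical
  have hf : f.Monic := Fact.out
  -- a `ℤ`-basis of `J` indexed by `Fin n`
  let bS : Module.Basis (Fin n) ℤ (AdjoinRoot f) := (AdjoinRoot.powerBasis' hf).basis.reindex (finCongr hdeg)
  let bJ : Module.Basis (Fin n) ℤ J := Ideal.selfBasis bS J hJ
  -- multiplication by `θ` on `J`, as a `ℤ`-linear map, and its matrix `A` on `bJ`
  let φ : J →ₗ[ℤ] J := (LinearMap.lsmul (AdjoinRoot f) J (AdjoinRoot.root f)).restrictScalars ℤ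
  have hφ : ∀ x : J, φ x = AdjoinRoot.root f • x := fun x ↦ rfl
  let A : _root_.Matrix (Fin n) (Fin n) ℤ := LinearMap.toMatrix bJ bJ φ
  -- the coordinate isomorphism `ℤⁿ ≅ J` intertwines `A` with multiplication by `θ`
  let g : (Fin n → ℤ) →+ J := bJ.equivFun.symm.toLinearMap.toAddMonoidHom
  have hg_apply : ∀ v, g v = bJ.equivFun.symm v := fun v ↦ rfl
  have hg : ∀ v, g (A.mulVec v) = AdjoinRoot.root f • g v := fun v ↦ by
    obtain ⟨x, rfl⟩ := bJ.equivFun.surjective v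
    rw [hg_apply, hg_apply, LinearEquiv.symm_apply_apply, Module.Basis.equivFun_apply,
      LinearMap.toMatrix_mulVec_repr, ← hφ, ← Module.Basis.equivFun_apply, LinearEquiv.symm_apply_apply]
  have hginj : Function.Injective g := fun v w h ↦ bJ.equivFun.symm.injective h
  -- `f(A) = 0`: `g (f(A) v) = f(θ) • g v = 0`
  have hA : aeval A f = 0 := by
    refine Matrix.toLin'.injective (LinearMap.ext fun v ↦ ?_)
    rw [Matrix.toLin'_apply, map_zero, LinearMap.zero_apply]
    apply hginj
    rw [map_aeval_mulVec g hg f v, AdjoinRoot.mk_self, zero_smul, map_zero]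
  refine ⟨A, hA, ⟨LinearEquiv.ofBijective (lift (hA := hA) g hg) ⟨fun x y hxy ↦ ?_, fun y ↦ ?_⟩⟩⟩
  · obtain ⟨v, rfl⟩ := (of f A hA).surjective x
    obtain ⟨w, rfl⟩ := (of f A hA).surjective y
    rw [lift_of, lift_of] at hxy
    rw [hginj hxy]
  · refine ⟨of f A hA (bJ.equivFun y), ?_⟩
    rw [lift_of, hg_apply, LinearEquiv.symm_apply_apply]

end QuotModule

/-! ### §3 The class maps on representatives -/

section Classes

variable {f : ℤ[X]} {A B : _root_.Matrix (Fin n) (Fin n) ℤ} {hA : aeval A f = 0} {hB : aeval B f = 0}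

/-- **Ideals in the same class come from conjugate matrices** (TAUSSKY's Theorems 2–3 read through §1): if
`ℤⁿ_A ≅ I`, `ℤⁿ_B ≅ J` and `(x)·I = (y)·J` with `x, y ≠ 0`, then `P A = B P` for a unimodular integer matrix
`P`. [cite: Taussky1949, Theorems 2–3] -/
theorem exists_isUnit_det_and_mul_eq_mul_of_linearEquiv [IsDomain (AdjoinRoot f)] {I J : Ideal (AdjoinRoot f)}
    (eA : QuotModule f A hA ≃ₗ[AdjoinRoot f] I) (eB : QuotModule f B hB ≃ₗ[AdjoinRoot f] J)
    {x y : AdjoinRoot f} (hx : x ≠ 0) (hy : y ≠ 0) (h : Ideal.span {x} * I = Ideal.span {y} * J) :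
    ∃ P : _root_.Matrix (Fin n) (Fin n) ℤ, IsUnit P.det ∧ P * A = B * P :=
  QuotModule.exists_isUnit_det_of_linearEquiv
    ((eA.trans (linearEquivOfSpanSingletonMulEq hx hy h)).trans eB.symm)

/-- **Conjugate matrices give ideals in the same class** (TAUSSKY's Theorem 3, «the matrices which correspond
to the same ideal class are of the form `S⁻¹AS`», read through §1): if `ℤⁿ_A ≅ I`, `ℤⁿ_B ≅ J` with `I ≠ 0`
and `P A = B P` with `P` unimodular, then `(x)·I = (y)·J` for some `x, y ≠ 0`. [cite: Taussky1949, Theorem 3]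
[cite: Iwaki2025, §2.3 Thm. 2.18] -/
theorem exists_span_singleton_mul_eq_of_mul_eq_mul [IsDomain (AdjoinRoot f)] {I J : Ideal (AdjoinRoot f)}
    (hI : I ≠ ⊥) (eA : QuotModule f A hA ≃ₗ[AdjoinRoot f] I) (eB : QuotModule f B hB ≃ₗ[AdjoinRoot f] J)
    {P : _root_.Matrix (Fin n) (Fin n) ℤ} (hPdet : IsUnit P.det) (hP : P * A = B * P) :
    ∃ x y : AdjoinRoot f, x ≠ 0 ∧ y ≠ 0 ∧ Ideal.span {x} * I = Ideal.span {y} * J :=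
  (nonempty_linearEquiv_iff_exists_span_singleton_mul_eq hI).1
    ⟨(eA.symm.trans (QuotModule.linearEquivOfConj (hA := hA) (hB := hB) P hPdet hP)).trans eB⟩

end Classes

/-! ### §4 The correspondence: classes of matrix roots of `f` ≃ ideal classes of `ℤ[θ]` -/

section Correspondence

variable {f : ℤ[X]} [Fact f.Monic] [IsDomain (AdjoinRoot f)]

/-- **The LATIMER–MACDUFFEE–TAUSSKY correspondence with module-isomorphism classes**: for `f ∈ ℤ[X]` monic of
degree `n ≥ 1` with `ℤ[θ] = ℤ[X]/(f)` a domain, there is a bijection `Φ` between the `GLₙ(ℤ)`-conjugacy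
classes of integer matrices `A` with `f(A) = 0` and the isomorphism classes of nonzero ideals of `ℤ[θ]`, with
`Φ [A] = [J]` whenever `ℤⁿ_A ≅ J` (well defined and injective by TAUSSKY's Theorems 2–3, everywhere defined by
Theorem 1, surjective by §2). [cite: Taussky1949, Theorems 1–4 («The Theorems 1-4 show that there is a 1-1
correspondence between the classes of matrices and the ideal classes»)] [cite: LatimerMacduffee1933]
[cite: Iwaki2025, §2.3 Thm. 2.18] -/
theorem exists_equiv_quot_conj_quot_linearEquiv (hdeg : f.natDegree = n) (hn : n ≠ 0) :
    ∃ Φ : Quot (fun A B : {A : _root_.Matrix (Fin n) (Fin n) ℤ // aeval A f = 0} ↦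
              ∃ P : _root_.Matrix (Fin n) (Fin n) ℤ, IsUnit P.det ∧ P * A.1 = B.1 * P) ≃
          Quot (fun I J : {J : Ideal (AdjoinRoot f) // J ≠ ⊥} ↦ Nonempty (I.1 ≃ₗ[AdjoinRoot f] J.1)),
      ∀ (A : _root_.Matrix (Fin n) (Fin n) ℤ) (hA : aeval A f = 0) (J : Ideal (AdjoinRoot f)) (hJ : J ≠ ⊥),
        Nonempty (QuotModule f A hA ≃ₗ[AdjoinRoot f] J) → Φ (Quot.mk _ ⟨A, hA⟩) = Quot.mk _ ⟨J, hJ⟩ := by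
  classical
  -- TAUSSKY's Theorem 1: the ideal of a matrix
  have hex : ∀ A : {A : _root_.Matrix (Fin n) (Fin n) ℤ // aeval A f = 0},
      ∃ J : {J : Ideal (AdjoinRoot f) // J ≠ ⊥}, Nonempty (QuotModule f A.1 A.2 ≃ₗ[AdjoinRoot f] J.1) :=
    fun A ↦ by
      obtain ⟨J, hJ, hJe⟩ := QuotModule.exists_linearEquiv_ideal (hA := A.2) hdeg hn
      exact ⟨⟨J, hJ⟩, hJe⟩
  choose ψ hψ using hex
  -- §2: the matrix of an ideal
  have hex' : ∀ J : {J : Ideal (AdjoinRoot f) // J ≠ ⊥},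
      ∃ A : {A : _root_.Matrix (Fin n) (Fin n) ℤ // aeval A f = 0},
        Nonempty (QuotModule f A.1 A.2 ≃ₗ[AdjoinRoot f] J.1) := fun J ↦ by
    obtain ⟨A, hA, hAe⟩ := QuotModule.exists_aeval_eq_zero_and_nonempty_linearEquiv hdeg J.2
    exact ⟨⟨A, hA⟩, hAe⟩
  choose χ hχ using hex'
  -- the two class maps are well defined
  let Φ : Quot (fun A B : {A : _root_.Matrix (Fin n) (Fin n) ℤ // aeval A f = 0} ↦
        ∃ P : _root_.Matrix (Fin n) (Fin n) ℤ, IsUnit P.det ∧ P * A.1 = B.1 * P) →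
      Quot (fun I J : {J : Ideal (AdjoinRoot f) // J ≠ ⊥} ↦ Nonempty (I.1 ≃ₗ[AdjoinRoot f] J.1)) :=
    Quot.lift (fun A ↦ Quot.mk _ (ψ A)) fun A B ⟨P, hPdet, hP⟩ ↦ Quot.sound <| by
      obtain ⟨eA⟩ := hψ A
      obtain ⟨eB⟩ := hψ B
      exact ⟨(eA.symm.trans (QuotModule.linearEquivOfConj (hA := A.2) (hB := B.2) P hPdet hP)).trans eB⟩
  let Ψ : Quot (fun I J : {J : Ideal (AdjoinRoot f) // J ≠ ⊥} ↦ Nonempty (I.1 ≃ₗ[AdjoinRoot f] J.1)) →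
      Quot (fun A B : {A : _root_.Matrix (Fin n) (Fin n) ℤ // aeval A f = 0} ↦
        ∃ P : _root_.Matrix (Fin n) (Fin n) ℤ, IsUnit P.det ∧ P * A.1 = B.1 * P) :=
    Quot.lift (fun J ↦ Quot.mk _ (χ J)) fun I J ⟨e⟩ ↦ Quot.sound <| by
      obtain ⟨eI⟩ := hχ I
      obtain ⟨eJ⟩ := hχ J
      exact QuotModule.exists_isUnit_det_of_linearEquiv ((eI.trans e).trans eJ.symm)
  have hΦ : ∀ (A : _root_.Matrix (Fin n) (Fin n) ℤ) (hA : aeval A f = 0) (J : Ideal (AdjoinRoot f))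
      (hJ : J ≠ ⊥), Nonempty (QuotModule f A hA ≃ₗ[AdjoinRoot f] J) →
        Φ (Quot.mk _ ⟨A, hA⟩) = Quot.mk _ ⟨J, hJ⟩ := fun A hA J hJ ⟨e⟩ ↦ by
    change Quot.mk _ (ψ ⟨A, hA⟩) = Quot.mk _ ⟨J, hJ⟩
    obtain ⟨eψ⟩ := hψ ⟨A, hA⟩
    exact Quot.sound ⟨eψ.symm.trans e⟩
  refine ⟨{ toFun := Φ, invFun := Ψ, left_inv := ?_, right_inv := ?_ }, hΦ⟩
  · rintro ⟨A⟩
    change Ψ (Quot.mk _ (ψ A)) = Quot.mk _ A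
    change Quot.mk _ (χ (ψ A)) = Quot.mk _ A
    obtain ⟨eχ⟩ := hχ (ψ A)
    obtain ⟨eψ⟩ := hψ A
    exact Quot.sound (QuotModule.exists_isUnit_det_of_linearEquiv (eχ.trans eψ.symm))
  · rintro ⟨J⟩
    change Φ (Quot.mk _ (χ J)) = Quot.mk _ J
    exact hΦ (χ J).1 (χ J).2 J.1 J.2 (hχ J)

/-- **THE LATIMER–MACDUFFEE–TAUSSKY CORRESPONDENCE «there is a bijection between `C(ℤ[θ])` and
`{A ∈ M(n;ℤ) | f(A) = O}/∼`»**: for `f ∈ ℤ[X]` monic of degree `n ≥ 1` with `ℤ[θ] = ℤ[X]/(f)` an integral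
domain, a bijection `Φ` from the `GLₙ(ℤ)`-conjugacy classes of integer matrices `A` with `f(A) = 0` onto the
ideal classes (`I ≈ J` iff `αI = βJ`, `α, β ≠ 0`) of the nonzero ideals of `ℤ[θ]`, with `Φ [A] = [J]` whenever
`ℤⁿ_A ≅ J` — in particular `Φ [A]` is the class of the ideal `ℤω₁ + ⋯ + ℤωₙ` of TAUSSKY's Theorem 1.
[cite: Taussky1949, Theorems 1–4] [cite: LatimerMacduffee1933] [cite: Iwaki2025, §2.3 Thm. 2.18]
[cite: KimYamada2023, §2.2 Thm. 2.13] -/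
theorem exists_equiv_quot_conj_quot_idealClass (hdeg : f.natDegree = n) (hn : n ≠ 0) :
    ∃ Φ : Quot (fun A B : {A : _root_.Matrix (Fin n) (Fin n) ℤ // aeval A f = 0} ↦
              ∃ P : _root_.Matrix (Fin n) (Fin n) ℤ, IsUnit P.det ∧ P * A.1 = B.1 * P) ≃
          Quot (fun I J : {J : Ideal (AdjoinRoot f) // J ≠ ⊥} ↦
            ∃ x y : AdjoinRoot f, x ≠ 0 ∧ y ≠ 0 ∧ Ideal.span {x} * I.1 = Ideal.span {y} * J.1),
      ∀ (A : _root_.Matrix (Fin n) (Fin n) ℤ) (hA : aeval A f = 0) (J : Ideal (AdjoinRoot f)) (hJ : J ≠ ⊥),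
        Nonempty (QuotModule f A hA ≃ₗ[AdjoinRoot f] J) → Φ (Quot.mk _ ⟨A, hA⟩) = Quot.mk _ ⟨J, hJ⟩ := by
  obtain ⟨Φ, hΦ⟩ := exists_equiv_quot_conj_quot_linearEquiv hdeg hn
  let ρ : Quot (fun I J : {J : Ideal (AdjoinRoot f) // J ≠ ⊥} ↦ Nonempty (I.1 ≃ₗ[AdjoinRoot f] J.1)) ≃
      Quot (fun I J : {J : Ideal (AdjoinRoot f) // J ≠ ⊥} ↦
        ∃ x y : AdjoinRoot f, x ≠ 0 ∧ y ≠ 0 ∧ Ideal.span {x} * I.1 = Ideal.span {y} * J.1) :=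
    Quot.congrRight fun I J ↦ nonempty_linearEquiv_iff_exists_span_singleton_mul_eq I.2
  refine ⟨Φ.trans ρ, fun A hA J hJ hAJ ↦ ?_⟩
  rw [Equiv.trans_apply, hΦ A hA J hJ hAJ]
  rfl

/-- **The number of classes of matrix solutions of `f(A) = 0` equals the number of ideal classes of `ℤ[θ]`**
(`Nat.card` of the two class sets; both are `0` when infinite). [cite: Taussky1949, p. 300 («a 1-1
correspondence between the classes of matrices […] and the ideal classes»)] [cite: Iwaki2025, §2.3 Thm. 2.18] -/
theorem natCard_quot_conj_eq_natCard_quot_idealClass (hdeg : f.natDegree = n) (hn : n ≠ 0) :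
    Nat.card (Quot (fun A B : {A : _root_.Matrix (Fin n) (Fin n) ℤ // aeval A f = 0} ↦
        ∃ P : _root_.Matrix (Fin n) (Fin n) ℤ, IsUnit P.det ∧ P * A.1 = B.1 * P)) =
      Nat.card (Quot (fun I J : {J : Ideal (AdjoinRoot f) // J ≠ ⊥} ↦
        ∃ x y : AdjoinRoot f, x ≠ 0 ∧ y ≠ 0 ∧ Ideal.span {x} * I.1 = Ideal.span {y} * J.1)) := by
  obtain ⟨Φ, -⟩ := exists_equiv_quot_conj_quot_idealClass hdeg hn
  exact Nat.card_congr Φ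

end Correspondence

/-! ### §5 «matrices whose characteristic polynomial is `f`» (KIM–YAMADA's wording) -/

section Charpoly

variable {f : ℤ[X]} [Fact f.Monic] [IsDomain (AdjoinRoot f)]

/-- **For `f` monic irreducible of degree `n ≥ 1`, an `n × n` integer matrix satisfies `f(A) = 0` iff its
characteristic polynomial is `f`** (⟸ CAYLEY–HAMILTON; ⟹: `χ_A(A) = 0`, so the class of `χ_A` in the domain
`ℤ[X]/(f)` kills the nonzero torsion-free module `ℤⁿ_A`, whence `f ∣ χ_A`, and both are monic of degree `n`) —
the two descriptions of the matrix side of the correspondence, «`{A ∈ M(n;ℤ) | f(A) = O}`» (IWAKI) and «matrices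
whose characteristic polynomials are `g`» (KIM–YAMADA), agree. [cite: Iwaki2025, §2.3 Thm. 2.18]
[cite: KimYamada2023, §2.2 Thm. 2.13] -/
theorem aeval_eq_zero_iff_charpoly_eq (hdeg : f.natDegree = n) (hn : n ≠ 0) (A : _root_.Matrix (Fin n) (Fin n) ℤ) :
    aeval A f = 0 ↔ A.charpoly = f := by
  refine ⟨fun hA ↦ ?_, fun h ↦ by rw [← h]; exact Matrix.aeval_self_charpoly A⟩
  have hf : f.Monic := Fact.out
  -- `[χ_A] • m = χ_A(A) m = 0` for the nonzero element `m = e₀` of the torsion-free module `ℤⁿ_A`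
  set e₀ : Fin n → ℤ := Pi.single (⟨0, Nat.pos_of_ne_zero hn⟩ : Fin n) 1 with he₀
  have hm0 : QuotModule.of f A hA e₀ ≠ 0 :=
    QuotModule.of_ne_zero (hA := hA) (by rw [he₀]; exact Pi.single_ne_zero_iff.2 one_ne_zero)
  have hsmul : AdjoinRoot.mk f A.charpoly • QuotModule.of f A hA e₀ = 0 := by
    rw [QuotModule.mk_smul_of, Matrix.aeval_self_charpoly, Matrix.zero_mulVec, map_zero]
  have hdvd : f ∣ A.charpoly :=
    AdjoinRoot.mk_eq_zero.1 ((smul_eq_zero.1 hsmul).resolve_right hm0)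
  exact eq_of_monic_of_dvd_of_natDegree_le hf (Matrix.charpoly_monic A) hdvd
    (by rw [Matrix.charpoly_natDegree_eq_dim, Fintype.card_fin, hdeg])

/-- **THE LATIMER–MACDUFFEE–TAUSSKY CORRESPONDENCE, characteristic-polynomial form «there is a bijection between
`C(ℤ[Θ])` and the set of similarity classes of matrices whose characteristic polynomials are `g`»** (`g = f`
monic irreducible of degree `n ≥ 1`, `ℤ[Θ] = ℤ[X]/(f)` a domain): a bijection `Φ` from the
`GLₙ(ℤ)`-conjugacy classes of `{A ∈ Mₙ(ℤ) | χ_A = f}` onto the ideal classes of `ℤ[Θ]`, with `Φ [A] = [J]`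
whenever `ℤⁿ_A ≅ J`. [cite: KimYamada2023, §2.2 Thm. 2.13] [cite: Taussky1949, Theorems 1–4]
[cite: LatimerMacduffee1933] -/
theorem exists_equiv_quot_charpoly_conj_quot_idealClass (hdeg : f.natDegree = n) (hn : n ≠ 0) :
    ∃ Φ : Quot (fun A B : {A : _root_.Matrix (Fin n) (Fin n) ℤ // A.charpoly = f} ↦
              ∃ P : _root_.Matrix (Fin n) (Fin n) ℤ, IsUnit P.det ∧ P * A.1 = B.1 * P) ≃
          Quot (fun I J : {J : Ideal (AdjoinRoot f) // J ≠ ⊥} ↦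
            ∃ x y : AdjoinRoot f, x ≠ 0 ∧ y ≠ 0 ∧ Ideal.span {x} * I.1 = Ideal.span {y} * J.1),
      ∀ (A : _root_.Matrix (Fin n) (Fin n) ℤ) (hA : A.charpoly = f) (J : Ideal (AdjoinRoot f)) (hJ : J ≠ ⊥),
        Nonempty (QuotModule f A ((aeval_eq_zero_iff_charpoly_eq hdeg hn A).2 hA) ≃ₗ[AdjoinRoot f] J) →
          Φ (Quot.mk _ ⟨A, hA⟩) = Quot.mk _ ⟨J, hJ⟩ := by
  obtain ⟨Φ, hΦ⟩ := exists_equiv_quot_conj_quot_idealClass hdeg hn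
  -- the two matrix sides have the same elements (§5) and the same relation
  let ε : {A : _root_.Matrix (Fin n) (Fin n) ℤ // A.charpoly = f} ≃
      {A : _root_.Matrix (Fin n) (Fin n) ℤ // aeval A f = 0} :=
    Equiv.subtypeEquivRight fun A ↦ (aeval_eq_zero_iff_charpoly_eq hdeg hn A).symm
  let ρ : Quot (fun A B : {A : _root_.Matrix (Fin n) (Fin n) ℤ // A.charpoly = f} ↦
        ∃ P : _root_.Matrix (Fin n) (Fin n) ℤ, IsUnit P.det ∧ P * A.1 = B.1 * P) ≃
      Quot (fun A B : {A : _root_.Matrix (Fin n) (Fin n) ℤ // aeval A f = 0} ↦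
        ∃ P : _root_.Matrix (Fin n) (Fin n) ℤ, IsUnit P.det ∧ P * A.1 = B.1 * P) :=
    Quot.congr ε fun _ _ ↦ Iff.rfl
  refine ⟨ρ.trans Φ, fun A hA J hJ hAJ ↦ ?_⟩
  rw [Equiv.trans_apply]
  exact hΦ A ((aeval_eq_zero_iff_charpoly_eq hdeg hn A).2 hA) J hJ hAJ

/-- **The number of similarity classes of integer matrices with characteristic polynomial `f` equals the ideal
class number `#C(ℤ[Θ])`** (as `Nat.card`). [cite: KimYamada2023, §2.2 Thm. 2.13] [cite: Iwaki2025, §2.3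
Thm. 2.18] -/
theorem natCard_quot_charpoly_conj_eq_natCard_quot_idealClass (hdeg : f.natDegree = n) (hn : n ≠ 0) :
    Nat.card (Quot (fun A B : {A : _root_.Matrix (Fin n) (Fin n) ℤ // A.charpoly = f} ↦
        ∃ P : _root_.Matrix (Fin n) (Fin n) ℤ, IsUnit P.det ∧ P * A.1 = B.1 * P)) =
      Nat.card (Quot (fun I J : {J : Ideal (AdjoinRoot f) // J ≠ ⊥} ↦
        ∃ x y : AdjoinRoot f, x ≠ 0 ∧ y ≠ 0 ∧ Ideal.span {x} * I.1 = Ideal.span {y} * J.1)) := by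
  obtain ⟨Φ, -⟩ := exists_equiv_quot_charpoly_conj_quot_idealClass hdeg hn
  exact Nat.card_congr Φ

end Charpoly

/-! ## §6. One class iff principal: `#C(S) = 1 ⟺ S` is a principal ideal ring, and the matrix form -/

section ClassNumberOne

variable {R : Type*} [CommRing R] [IsDomain R]

/-- The ideal-class relation `I ≈ J ⟺ (x) I = (y) J` (`x, y ≠ 0`) on the nonzero ideals of a domain is an
equivalence relation (Kim–Yamada: "Define an equivalence relation `≈` on `𝓘(R)` by `I ≈ J` if and only if there
exist non-zero elements `α, β` such that `αI = βJ`"; transitivity: `x'x I = x' y J = y y' K`). [cite: KimYamada2023, §2.2 (definition of the ideal class monoid)]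
[cite: AitchisonRubinstein1984, Appendix (Conjugacy in SL(3,Z)), p. 56] -/
theorem idealClass_equivalence :
    Equivalence (fun I J : {J : Ideal R // J ≠ ⊥} ↦
      ∃ x y : R, x ≠ 0 ∧ y ≠ 0 ∧ Ideal.span {x} * I.1 = Ideal.span {y} * J.1) where
  refl I := ⟨1, 1, one_ne_zero, one_ne_zero, rfl⟩
  symm := fun ⟨x, y, hx, hy, h⟩ ↦ ⟨y, x, hy, hx, h.symm⟩
  trans := fun ⟨x, y, hx, hy, h⟩ ⟨x', y', hx', hy', h'⟩ ↦
    ⟨x' * x, y * y', mul_ne_zero hx' hx, mul_ne_zero hy hy', by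
      rw [← Ideal.span_singleton_mul_span_singleton, mul_assoc, h, ← mul_assoc,
        mul_comm (Ideal.span {x'}), mul_assoc, h', ← mul_assoc, Ideal.span_singleton_mul_span_singleton]⟩

/-- Two nonzero ideals have the same class in the quotient iff they are related (the relation being an
equivalence relation, `Quot.mk` identifies exactly the related pairs). [cite: KimYamada2023, §2.2 (definition of the ideal class monoid)] -/
theorem quotMk_idealClass_eq_iff (I J : {J : Ideal R // J ≠ ⊥}) :
    Quot.mk (fun I J : {J : Ideal R // J ≠ ⊥} ↦
        ∃ x y : R, x ≠ 0 ∧ y ≠ 0 ∧ Ideal.span {x} * I.1 = Ideal.span {y} * J.1) I = Quot.mk _ J ↔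
      ∃ x y : R, x ≠ 0 ∧ y ≠ 0 ∧ Ideal.span {x} * I.1 = Ideal.span {y} * J.1 :=
  Quot.eq.trans idealClass_equivalence.eqvGen_iff

/-- **"The identity element is the class of principal ideals"**: a nonzero ideal `J` of a domain is in the class
of `R` itself (`(x) J = (y) R` for some nonzero `x, y`) iff `J` is principal (`⟸`: `(1) (j) = (j) R`; `⟹`:
`y = x j₀` with `j₀ ∈ J`, so `(x) J = (x)(j₀)` and `J = (j₀)` by cancelling the nonzero principal ideal `(x)`).
[cite: KimYamada2023, §2.2 ("The identity element is the class of principal ideals")]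
[cite: AitchisonRubinstein1984, Appendix (Conjugacy in SL(3,Z)), p. 56 ("Clearly any two principal ideals are equivalent … identity the class of principal ideals")] -/
theorem idealClass_top_iff_isPrincipal {J : Ideal R} (hJ : J ≠ ⊥) :
    (∃ x y : R, x ≠ 0 ∧ y ≠ 0 ∧ Ideal.span {x} * J = Ideal.span {y} * ⊤) ↔ J.IsPrincipal := by
  constructor
  · rintro ⟨x, y, hx, -, h⟩
    rw [Ideal.mul_top] at h
    obtain ⟨j, hj, hxj⟩ := Ideal.mem_span_singleton_mul.1 (h ▸ Ideal.mem_span_singleton_self y)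
    have hJ' : Ideal.span {x} * J = Ideal.span {x} * Ideal.span {j} := by
      rw [h, Ideal.span_singleton_mul_span_singleton, hxj]
    exact ⟨j, (Ideal.span_singleton_mul_right_inj hx).1 hJ'⟩
  · rintro ⟨j, rfl⟩
    have hj : j ≠ 0 := fun h0 ↦ hJ (Ideal.span_singleton_eq_bot.2 h0)
    refine ⟨1, j, one_ne_zero, hj, ?_⟩
    rw [Ideal.span_singleton_one, Ideal.top_mul, Ideal.mul_top]

/-- **All nonzero ideals of a domain lie in ONE class iff the domain is a principal ideal ring** (pointwise form
of `#C(R) = 1`: every class is the class of `R`, which consists of the principal ideals). [cite: KimYamada2023, §2.2 (ideal class monoid; Rem. 2.11)]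
[cite: AitchisonRubinstein1984, Appendix (Conjugacy in SL(3,Z)), p. 56] -/
theorem forall_idealClass_iff_isPrincipalIdealRing :
    (∀ I J : Ideal R, I ≠ ⊥ → J ≠ ⊥ →
        ∃ x y : R, x ≠ 0 ∧ y ≠ 0 ∧ Ideal.span {x} * I = Ideal.span {y} * J) ↔ IsPrincipalIdealRing R := by
  have htop : (⊤ : Ideal R) ≠ ⊥ := top_ne_bot
  constructor
  · intro h
    refine ⟨fun J ↦ ?_⟩
    by_cases hJ : J = ⊥
    · rw [hJ]
      exact ⟨0, by simp⟩
    · exact (idealClass_top_iff_isPrincipal hJ).1 (h J ⊤ hJ htop)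
  · intro hR I J hI hJ
    have hI' := (idealClass_top_iff_isPrincipal hI).2 (IsPrincipalIdealRing.principal I)
    have hJ' := (idealClass_top_iff_isPrincipal hJ).2 (IsPrincipalIdealRing.principal J)
    exact idealClass_equivalence.trans (x := ⟨I, hI⟩) (y := ⟨⊤, htop⟩) (z := ⟨J, hJ⟩) hI'
      (idealClass_equivalence.symm (x := ⟨J, hJ⟩) (y := ⟨⊤, htop⟩) hJ')

/-- **`#C(R) = 1 ⟺ R` is a principal ideal ring**, for any domain `R`: the ideal class monoid (nonzero ideals
modulo `(x) I = (y) J`, as `Nat.card` of the quotient) is trivial iff every ideal is principal. (For an infinite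
class monoid `Nat.card = 0`, consistent with the statement.) [cite: KimYamada2023, §2.2 (ideal class monoid; Rem. 2.11, Ex. 2.12)]
[cite: AitchisonRubinstein1984, Appendix (Conjugacy in SL(3,Z)), p. 56] -/
theorem natCard_quot_idealClass_eq_one_iff :
    Nat.card (Quot (fun I J : {J : Ideal R // J ≠ ⊥} ↦
        ∃ x y : R, x ≠ 0 ∧ y ≠ 0 ∧ Ideal.span {x} * I.1 = Ideal.span {y} * J.1)) = 1 ↔
      IsPrincipalIdealRing R := by
  have htop : (⊤ : Ideal R) ≠ ⊥ := top_ne_bot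
  rw [Nat.card_eq_one_iff_unique, ← forall_idealClass_iff_isPrincipalIdealRing]
  constructor
  · rintro ⟨hsub, -⟩ I J hI hJ
    exact (quotMk_idealClass_eq_iff ⟨I, hI⟩ ⟨J, hJ⟩).1 (hsub.elim _ _)
  · intro h
    refine ⟨⟨fun p q ↦ ?_⟩, ⟨Quot.mk _ ⟨⊤, htop⟩⟩⟩
    induction p using Quot.ind with | _ I => ?_
    induction q using Quot.ind with | _ J => ?_
    exact (quotMk_idealClass_eq_iff I J).2 (h I.1 J.1 I.2 J.2)

variable {n : ℕ} {f : ℤ[X]} [Fact f.Monic] [IsDomain (AdjoinRoot f)]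

/-- **Latimer–MacDuffee–Taussky, class number one as an equivalence**: for `f ∈ ℤ[X]` monic of degree `n ≥ 1`
with `ℤ[X]/(f)` a domain, ALL `n × n` integer matrices with characteristic polynomial `f` are similar over `ℤ`
(conjugate by some `P` with `det P = ±1`) iff `ℤ[θ] = ℤ[X]/(f)` is a principal ideal ring (`⟸` is the tree's
`exists_isUnit_det_and_mul_eq_mul_of_isPrincipalIdealRing`, here recovered from the correspondence; `⟹`: by §2
every nonzero ideal is the module of some matrix, so any two nonzero ideals are in the same class). [cite: Taussky1949, Theorems 1–4]
[cite: AitchisonRubinstein1984, Appendix (Conjugacy in SL(3,Z)), Theorem (Newman) and p. 56] [cite: LatimerMacduffee1933] -/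
theorem forall_exists_isUnit_det_iff_isPrincipalIdealRing (hdeg : f.natDegree = n) (hn : n ≠ 0) :
    (∀ A B : _root_.Matrix (Fin n) (Fin n) ℤ, A.charpoly = f → B.charpoly = f →
        ∃ P : _root_.Matrix (Fin n) (Fin n) ℤ, IsUnit P.det ∧ P * A = B * P) ↔
      IsPrincipalIdealRing (AdjoinRoot f) := by
  obtain ⟨Φ, hΦ⟩ := exists_equiv_quot_charpoly_conj_quot_idealClass (f := f) hdeg hn
  rw [← forall_idealClass_iff_isPrincipalIdealRing]
  constructor
  · intro h I J hI hJ
    -- both ideals are modules of matrices (§2), which are conjugate by `h`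
    obtain ⟨A, hA, ⟨eA⟩⟩ := QuotModule.exists_aeval_eq_zero_and_nonempty_linearEquiv (f := f) hdeg hI
    obtain ⟨B, hB, ⟨eB⟩⟩ := QuotModule.exists_aeval_eq_zero_and_nonempty_linearEquiv (f := f) hdeg hJ
    obtain ⟨P, hP, hPAB⟩ := h A B ((aeval_eq_zero_iff_charpoly_eq hdeg hn A).1 hA)
      ((aeval_eq_zero_iff_charpoly_eq hdeg hn B).1 hB)
    exact exists_span_singleton_mul_eq_of_mul_eq_mul hI eA eB hP hPAB
  · intro h A B hA hB
    have hA0 := (aeval_eq_zero_iff_charpoly_eq hdeg hn A).2 hA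
    have hB0 := (aeval_eq_zero_iff_charpoly_eq hdeg hn B).2 hB
    obtain ⟨I, hI, ⟨eA⟩⟩ := QuotModule.exists_linearEquiv_ideal (f := f) (A := A) (hA := hA0) hdeg hn
    obtain ⟨J, hJ, ⟨eB⟩⟩ := QuotModule.exists_linearEquiv_ideal (f := f) (A := B) (hA := hB0) hdeg hn
    obtain ⟨x, y, hx, hy, hxy⟩ := h I J hI hJ
    exact exists_isUnit_det_and_mul_eq_mul_of_linearEquiv eA eB hx hy hxy

/-- **The number of similarity classes of integer matrices with characteristic polynomial `f` is `1` iff `ℤ[θ]`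
is a principal ideal ring** (`#classes = #C(ℤ[θ])`, §5, and `natCard_quot_idealClass_eq_one_iff`). [cite: AitchisonRubinstein1984, Appendix (Conjugacy in SL(3,Z)), Theorem (Newman) and p. 56]
[cite: KimYamada2023, §2.2 Thm. 2.13] [cite: Taussky1949, Theorems 1–4] -/
theorem natCard_quot_charpoly_conj_eq_one_iff (hdeg : f.natDegree = n) (hn : n ≠ 0) :
    Nat.card (Quot (fun A B : {A : _root_.Matrix (Fin n) (Fin n) ℤ // A.charpoly = f} ↦
        ∃ P : _root_.Matrix (Fin n) (Fin n) ℤ, IsUnit P.det ∧ P * A.1 = B.1 * P)) = 1 ↔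
      IsPrincipalIdealRing (AdjoinRoot f) := by
  rw [natCard_quot_charpoly_conj_eq_natCard_quot_idealClass hdeg hn, natCard_quot_idealClass_eq_one_iff]

end ClassNumberOne

end Literature.LinearAlgebra.Matrix
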